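import Summits.QuantumFields.YangMills.Theorems.BalabanUVNodesPortS1LZdetPiecesDefs

/-!
# NODE O port PT-A — ROWS (c) LOCALITY AND (d) GAUGE INVARIANCE OF THE GAUSSIAN-BRACKET PIECES `lzdetPiece` (v3.3 glue `stub_LZdetGlue`, 27930 line `pta_residueW`): the pieces read the pair only
# through the sites of `X` (from (P4-loc) of the pieces `TY` on sub-domains and (g4) of the resolvent pieces), and are invariant under the (1.10) action (from (P3) PIECEWISE covariance through the
# bond-block-diagonal `AdM` — which COMMUTES with the non-b₀ projection, so traces of products of non-b₀ blocks are invariant — and (g6))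

Cell `ym-nodeO-ideate`, porter seat `ymgap-nodeO-port-PTA-1` (gen 7); `--supports stmt-QuantumFields-27930` (helper, P0-free).  [I] = [Balaban1987RG1], [16] = [Balaban1985UV3].
* §1 `subset_foldr_union_of_mem`, `locPowPiece_congr_of_subset`, `powMemberPiece_congr_of_subset` — a piece of `U` reads only the `T_i` with `supp i ⊆ U`.
* §2 `domSites_mono`; ★ `lzdetGPiece_congr_of_agreeOnSet` ∕ `lzdetPiece_congr_of_agreeOnSet` — ROW (c).
* §3 the non-b₀ RESTRICTION algebra: `nonB0Block_mul_of_rowPattern` ∕ `…_of_colPattern` (restriction is multiplicative against a factor that does not couple non-b₀ and b₀ indices),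
  `colPattern_inv_of_blockDiag` (an invertible bond-block-diagonal `AdM` has an inverse with the same non-b₀∕b₀ zero pattern — it commutes with the non-b₀ indicator), `nonB0Block_conj`,
  `trace_prod_map_conj` (traces of products of conjugated blocks), ★ `locPowPiece_conj` ∕ `powMemberPiece_conj`.
* §4 ★ `lzdetGPiece_cAct` ∕ `lzdetPiece_cAct` — ROW (d).

HONEST FRAMING.  Finite-dimensional algebra over displayed clause shapes ((P3)(P4-loc) of DEF-1 ed.23, (g4)(g6) of `G3CPiecesAt`); nothing of Bałaban asserted; `stub_P0C` ∕ `stub_G3C` ∕ `stub_LZdetGlue` ∕ `stub_FE` OPEN;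
27930 OPEN (stubs 2∕6 by name) · no claim; NODE O 0∕1; COUNT 8∕28 · K 1∕4 UNMOVED; finite `𝕋⁴_{L^K}` at fixed ε — NOT continuum ∕ OS ∕ Clay; **the Yang–Mills mass gap is NOT proved by any of this.**
No `sorry`, no `def`, no `instance`; standard axioms.
-/

noncomputable section

open scoped BigOperators Matrix.Norms.L2Operator
open Finset

namespace Summit.QuantumFields.YangMills.Theorems.BalabanUVNodesPortS1

open Summit.QuantumFields.YangMills.Theorems.K0RecordFormatNames
open Literature.MathematicalPhysics.QuantumFieldTheory.Balaban1983to89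
open Literature.MathematicalPhysics.QuantumFieldTheory.Balaban1983to89.Node00
open Literature.MathematicalPhysics.QuantumFieldTheory.Balaban1983to89.T4Continuum (T4Family)
open Literature.MathematicalPhysics.QuantumFieldTheory.Balaban1983to89.TreeLengthTorus (TPt)

/-! ## §1  A piece of `U` reads only the `T_i` with `supp i ⊆ U` -/

section Congr

variable {S : Type} [Fintype S] [DecidableEq S] {Q : Type} [Fintype Q] [DecidableEq Q] {ι : Type} [Fintype ι] [DecidableEq ι]

omit [Fintype S] [DecidableEq S] [Fintype Q] [Fintype ι] [DecidableEq ι] in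
/-- A member's support lies in the folded union of the supports. [folklore] -/
theorem subset_foldr_union_of_mem (supp : ι → Finset Q) : ∀ {l : List ι} {i : ι}, i ∈ l → supp i ⊆ (l.map supp).foldr (· ∪ ·) ∅
  | [], _, hi => absurd hi List.not_mem_nil
  | j :: l, i, hi => by
    rw [List.map_cons, List.foldr_cons]
    rcases List.mem_cons.1 hi with rfl | h
    · exact Finset.subset_union_left
    · exact (subset_foldr_union_of_mem supp h).trans Finset.subset_union_right

omit [Fintype Q] in
/-- **A piece of `U` reads only the pieces supported inside `U`**: families agreeing on `{i : supp i ⊆ U}` have the same `locPowPiece … U`. [cite: Balaban1987RG1, (1.7) p.261 (bookkeeping)] -/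
theorem locPowPiece_congr_of_subset (supp : ι → Finset Q) {T T' : ι → Matrix S S ℂ} {U : Finset Q} (h : ∀ i, supp i ⊆ U → T i = T' i) (m : ℕ) :
    locPowPiece supp T m U = locPowPiece supp T' m U := by
  unfold locPowPiece
  refine sum_congr rfl fun l hl => ?_
  obtain ⟨-, -, hU⟩ := mem_filter.1 hl
  have hmap : l.map T = l.map T' := List.map_congr_left fun i hi => h i (hU ▸ subset_foldr_union_of_mem supp hi)
  rw [hmap]

omit [Fintype Q] in
/-- The same for the series of the power members. [cite: Balaban1987RG1, (1.7) p.261 (bookkeeping)] -/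
theorem powMemberPiece_congr_of_subset (supp : ι → Finset Q) {T T' : ι → Matrix S S ℂ} {U : Finset Q} (h : ∀ i, supp i ⊆ U → T i = T' i) (R : ℝ) :
    powMemberPiece supp T R U = powMemberPiece supp T' R U := by
  unfold powMemberPiece
  exact tsum_congr fun j => by rw [locPowPiece_congr_of_subset supp h]

end Congr

/-! ## §2  ROW (c): locality on the sites of `X` -/

section Locality

variable (F : T4Family)

/-- The site set of a domain is monotone in its cube family. [cite: Balaban1987RG1, p.257 (bookkeeping)] -/
theorem domSites_mono {P : Params} (M j : ℕ) {Y X : (Sect2.domSys P M j).Dom} (h : (Y.1 : Finset _) ⊆ X.1) :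
    Sect2.domSites P M j Y ⊆ Sect2.domSites P M j X := by
  intro x hx
  simp only [Sect2.domSites, Set.mem_iUnion] at hx ⊢
  obtain ⟨c, hc, hxc⟩ := hx
  exact ⟨c, h hc, hxc⟩

open scoped Classical in
/-- ★ **ROW (c) for the unsubtracted piece**: if the resolvent pieces of `X` and the carrier pieces of every `Y ⊆ X` read the pair only on their sites, `G_X` reads it only on the sites of `X`.
[cite: Balaban1987RG1, (1.7) p.261] -/
theorem lzdetGPiece_congr_of_agreeOnSet (Mc k K : ℕ)
    (TYK : (recordDomSys F Mc k K).Dom → Sect2.CPair (F.P K) (MatA 2) → FluctIdx F k K → FluctIdx F k K → ℂ)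
    (EGK : ℝ → (recordDomSys F Mc k K).Dom → Sect2.CPair (F.P K) (MatA 2) → ℂ) (R : ℝ) (X : (recordDomSys F Mc k K).Dom)
    (hTYloc : ∀ (Y : (recordDomSys F Mc k K).Dom) (φ ψ : Sect2.CPair (F.P K) (MatA 2)),
      Sect2.agreeOnSet (Sect2.domSites (F.P K) Mc (k + 1) Y) φ ψ → TYK Y φ = TYK Y ψ)
    (hEGloc : ∀ (x : ℝ) (φ ψ : Sect2.CPair (F.P K) (MatA 2)), Sect2.agreeOnSet (Sect2.domSites (F.P K) Mc (k + 1) X) φ ψ → EGK x X φ = EGK x X ψ)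
    {φ ψ : Sect2.CPair (F.P K) (MatA 2)} (hag : Sect2.agreeOnSet (Sect2.domSites (F.P K) Mc (k + 1) X) φ ψ) :
    lzdetGPiece F Mc k K TYK EGK R X φ = lzdetGPiece F Mc k K TYK EGK R X ψ := by
  unfold lzdetGPiece
  have hint : (∫ x in (0 : ℝ)..R, EGK x X φ) = ∫ x in (0 : ℝ)..R, EGK x X ψ :=
    intervalIntegral.integral_congr fun x _ => hEGloc x φ ψ hag
  have hpow := powMemberPiece_congr_of_subset (S := NonB0Idx F k K) (fun Y : (recordDomSys F Mc k K).Dom => (Y.1 : Finset (TPt (F.P K).d (Sect2.domCount (F.P K) Mc (k + 1)))))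
    (T := fun Y => nonB0Block F k K (TYK Y φ)) (T' := fun Y => nonB0Block F k K (TYK Y ψ)) (U := X.1)
    (fun Y hY => by simp only [hTYloc Y φ ψ (Sect2.agreeOnSet_mono (domSites_mono Mc (k + 1) hY) hag)]) R
  rw [hint, hpow]

open scoped Classical in
/-- ★ **ROW (c)**: `lzdetPiece … X` reads the pair only on the sites of `X`. [cite: Balaban1987RG1, (1.7) p.261] -/
theorem lzdetPiece_congr_of_agreeOnSet (Mc k K : ℕ)
    (TYK : (recordDomSys F Mc k K).Dom → Sect2.CPair (F.P K) (MatA 2) → FluctIdx F k K → FluctIdx F k K → ℂ)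
    (EGK : ℝ → (recordDomSys F Mc k K).Dom → Sect2.CPair (F.P K) (MatA 2) → ℂ) (R : ℝ) (X : (recordDomSys F Mc k K).Dom)
    (hTYloc : ∀ (Y : (recordDomSys F Mc k K).Dom) (φ ψ : Sect2.CPair (F.P K) (MatA 2)),
      Sect2.agreeOnSet (Sect2.domSites (F.P K) Mc (k + 1) Y) φ ψ → TYK Y φ = TYK Y ψ)
    (hEGloc : ∀ (x : ℝ) (φ ψ : Sect2.CPair (F.P K) (MatA 2)), Sect2.agreeOnSet (Sect2.domSites (F.P K) Mc (k + 1) X) φ ψ → EGK x X φ = EGK x X ψ)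
    {φ ψ : Sect2.CPair (F.P K) (MatA 2)} (hag : Sect2.agreeOnSet (Sect2.domSites (F.P K) Mc (k + 1) X) φ ψ) :
    lzdetPiece F Mc k K TYK EGK R X φ = lzdetPiece F Mc k K TYK EGK R X ψ := by
  unfold lzdetPiece
  rw [lzdetGPiece_congr_of_agreeOnSet F Mc k K TYK EGK R X hTYloc hEGloc hag]

end Locality

/-! ## §3  The non-b₀ restriction against bond-block-diagonal conjugation -/

section Conj

variable {S : Type} [Fintype S] [DecidableEq S] {Q : Type} [Fintype Q] [DecidableEq Q] {ι : Type} [Fintype ι] [DecidableEq ι]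

omit [Fintype Q] [DecidableEq Q] [Fintype ι] [DecidableEq ι] in
/-- Products of two-sided conjugates telescope: `Π_i (A T_i B) = A (Π_i T_i) B` when `B A = 1 = A B`. [folklore] -/
theorem prod_map_conj {A B : Matrix S S ℂ} (hAB : A * B = 1) (hBA : B * A = 1) (T : ι → Matrix S S ℂ) :
    ∀ l : List ι, (l.map fun i => A * T i * B).prod = A * (l.map T).prod * B
  | [] => by simp [hAB]
  | i :: l => by
    rw [List.map_cons, List.prod_cons, prod_map_conj hAB hBA T l, List.map_cons, List.prod_cons]
    calc A * T i * B * (A * (l.map T).prod * B) = A * T i * (B * A) * (l.map T).prod * B := by simp only [Matrix.mul_assoc]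
      _ = A * (T i * (l.map T).prod) * B := by rw [hBA, Matrix.mul_one, Matrix.mul_assoc A]

omit [Fintype Q] in
/-- ★ **Conjugating every piece by an invertible pair leaves the localized power pieces unchanged** (traces of telescoped products). [cite: Balaban1987RG1, (1.19) p.263 (bookkeeping)] -/
theorem locPowPiece_conj (supp : ι → Finset Q) {A B : Matrix S S ℂ} (hAB : A * B = 1) (hBA : B * A = 1) (T : ι → Matrix S S ℂ) (m : ℕ) (U : Finset Q) :
    locPowPiece supp (fun i => A * T i * B) m U = locPowPiece supp T m U := by
  unfold locPowPiece
  refine sum_congr rfl fun l _ => ?_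
  rw [prod_map_conj hAB hBA T l]
  calc (A * (l.map T).prod * B).trace = (B * A * (l.map T).prod).trace := by rw [Matrix.trace_mul_comm, ← Matrix.mul_assoc]
    _ = ((l.map T).prod).trace := by rw [hBA, Matrix.one_mul]

omit [Fintype Q] in
/-- The same for the series of the power members. [cite: Balaban1987RG1, (1.19) p.263 (bookkeeping)] -/
theorem powMemberPiece_conj (supp : ι → Finset Q) {A B : Matrix S S ℂ} (hAB : A * B = 1) (hBA : B * A = 1) (T : ι → Matrix S S ℂ) (R : ℝ) (U : Finset Q) :
    powMemberPiece supp (fun i => A * T i * B) R U = powMemberPiece supp T R U := by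
  unfold powMemberPiece
  exact tsum_congr fun j => by rw [locPowPiece_conj supp hAB hBA]

end Conj

section NonB0

variable (F : T4Family) {k K : ℕ}

/-- A sum over `FluctIdx` of a function vanishing on the b₀ indices is the sum over `NonB0Idx`. [folklore] -/
theorem sum_fluctIdx_eq_sum_nonB0 (f : FluctIdx F k K → ℂ) (hf : ∀ l : FluctIdx F k K, l.1 ∈ Set.range (recordB0 F k K) → f l = 0) :
    ∑ l, f l = ∑ l : NonB0Idx F k K, f l.1 := by
  classical
  rw [← Finset.sum_filter_of_ne (p := fun l : FluctIdx F k K => l.1 ∉ Set.range (recordB0 F k K)) (fun l _ hl => fun hmem => hl (hf l hmem))]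
  exact Finset.sum_bij (fun l hl => (⟨l, (mem_filter.1 hl).2⟩ : NonB0Idx F k K)) (fun _ _ => mem_univ _) (fun _ _ _ _ h => congrArg Subtype.val h)
    (fun i _ => ⟨i.1, mem_filter.2 ⟨mem_univ _, i.2⟩, rfl⟩) (fun _ _ => rfl)

/-- **Restriction is multiplicative against a LEFT factor that does not couple non-b₀ rows with b₀ columns.** [folklore] -/
theorem nonB0Block_mul_left (D M : Matrix (FluctIdx F k K) (FluctIdx F k K) ℂ)
    (hpat : ∀ (i : NonB0Idx F k K) (l : FluctIdx F k K), l.1 ∈ Set.range (recordB0 F k K) → D i.1 l = 0) :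
    nonB0Block F k K (fun i j => (D * M) i j) = nonB0Block F k K (fun i j => D i j) * nonB0Block F k K (fun i j => M i j) := by
  ext i j
  simp only [nonB0Block, Matrix.of_apply, Matrix.mul_apply]
  exact sum_fluctIdx_eq_sum_nonB0 F _ fun l hl => by rw [hpat i l hl, zero_mul]

/-- **Restriction is multiplicative against a RIGHT factor that does not couple b₀ rows with non-b₀ columns.** [folklore] -/
theorem nonB0Block_mul_right (M E : Matrix (FluctIdx F k K) (FluctIdx F k K) ℂ)
    (hpat : ∀ (l : FluctIdx F k K) (j : NonB0Idx F k K), l.1 ∈ Set.range (recordB0 F k K) → E l j.1 = 0) :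
    nonB0Block F k K (fun i j => (M * E) i j) = nonB0Block F k K (fun i j => M i j) * nonB0Block F k K (fun i j => E i j) := by
  ext i j
  simp only [nonB0Block, Matrix.of_apply, Matrix.mul_apply]
  exact sum_fluctIdx_eq_sum_nonB0 F _ fun l hl => by rw [hpat l j hl, mul_zero]

/-- The restriction of the identity is the identity. [folklore] -/
theorem nonB0Block_one : nonB0Block F k K (fun i j => (1 : Matrix (FluctIdx F k K) (FluctIdx F k K) ℂ) i j) = 1 := by
  ext i j
  simp only [nonB0Block, Matrix.of_apply, Matrix.one_apply, Subtype.ext_iff]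

/-- **A bond-block-diagonal matrix does not couple non-b₀ and b₀ indices** (both zero patterns). [cite: Balaban1987RG1, (1.10) p.262 (bookkeeping)] -/
theorem patterns_of_blockDiag {D : Matrix (FluctIdx F k K) (FluctIdx F k K) ℂ} (hD : ∀ i j : FluctIdx F k K, i.1 ≠ j.1 → D i j = 0) :
    (∀ (i : NonB0Idx F k K) (l : FluctIdx F k K), l.1 ∈ Set.range (recordB0 F k K) → D i.1 l = 0) ∧
    (∀ (l : FluctIdx F k K) (j : NonB0Idx F k K), l.1 ∈ Set.range (recordB0 F k K) → D l j.1 = 0) := by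
  refine ⟨fun i l hl => hD _ _ fun h => i.2 (h ▸ hl), fun l j hl => hD _ _ fun h => j.2 (h ▸ hl)⟩

/-- **The inverse of an invertible bond-block-diagonal matrix has the same non-b₀∕b₀ zero patterns** (it commutes with the non-b₀ indicator, hence so does its inverse).
[cite: Balaban1987RG1, (1.10) p.262 (bookkeeping)] -/
theorem patterns_inv_of_blockDiag {D : Matrix (FluctIdx F k K) (FluctIdx F k K) ℂ} (hD : ∀ i j : FluctIdx F k K, i.1 ≠ j.1 → D i j = 0) (hU : IsUnit D) :
    (∀ (i : NonB0Idx F k K) (l : FluctIdx F k K), l.1 ∈ Set.range (recordB0 F k K) → D⁻¹ i.1 l = 0) ∧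
    (∀ (l : FluctIdx F k K) (j : NonB0Idx F k K), l.1 ∈ Set.range (recordB0 F k K) → D⁻¹ l j.1 = 0) := by
  classical
  -- the non-b₀ indicator
  set Pm : Matrix (FluctIdx F k K) (FluctIdx F k K) ℂ := Matrix.diagonal fun l => if l.1 ∈ Set.range (recordB0 F k K) then 0 else 1 with hPm
  have hcomm : D * Pm = Pm * D := by
    ext i j
    rw [hPm, Matrix.mul_diagonal, Matrix.diagonal_mul]
    by_cases hij : i.1 = j.1
    · rw [hij]; split_ifs <;> simp
    · rw [hD i j hij]; simp
  have hdet : IsUnit D.det := (Matrix.isUnit_iff_isUnit_det D).1 hU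
  have hinv : D⁻¹ * Pm = Pm * D⁻¹ := by
    calc D⁻¹ * Pm = D⁻¹ * Pm * (D * D⁻¹) := by rw [Matrix.mul_nonsing_inv _ hdet, Matrix.mul_one]
      _ = D⁻¹ * (Pm * D) * D⁻¹ := by simp only [Matrix.mul_assoc]
      _ = D⁻¹ * (D * Pm) * D⁻¹ := by rw [hcomm]
      _ = (D⁻¹ * D) * Pm * D⁻¹ := by simp only [Matrix.mul_assoc]
      _ = Pm * D⁻¹ := by rw [Matrix.nonsing_inv_mul _ hdet, Matrix.one_mul]
  have hentry : ∀ i j : FluctIdx F k K, (D⁻¹ * Pm) i j = (Pm * D⁻¹) i j := fun i j => by rw [hinv]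
  constructor
  · intro i l hl
    have h := hentry i.1 l
    rw [hPm, Matrix.mul_diagonal, Matrix.diagonal_mul, if_pos hl, if_neg i.2] at h
    simpa using h.symm
  · intro l j hl
    have h := hentry l j.1
    rw [hPm, Matrix.mul_diagonal, Matrix.diagonal_mul, if_neg j.2, if_pos hl] at h
    simpa using h

/-- ★ **THE NON-b₀ BLOCK OF A CONJUGATE**: for an invertible bond-block-diagonal `D`, `res (D M D⁻¹) = res D · res M · res D⁻¹` with `res D · res D⁻¹ = 1 = res D⁻¹ · res D`.
[cite: Balaban1987RG1, (1.10) p.262, (1.19) p.263 (bookkeeping)] -/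
theorem nonB0Block_conj {D : Matrix (FluctIdx F k K) (FluctIdx F k K) ℂ} (hD : ∀ i j : FluctIdx F k K, i.1 ≠ j.1 → D i j = 0) (hU : IsUnit D)
    (M : Matrix (FluctIdx F k K) (FluctIdx F k K) ℂ) :
    nonB0Block F k K (fun i j => (D * M * D⁻¹) i j) =
      nonB0Block F k K (fun i j => D i j) * nonB0Block F k K (fun i j => M i j) * nonB0Block F k K (fun i j => D⁻¹ i j) ∧
    nonB0Block F k K (fun i j => D i j) * nonB0Block F k K (fun i j => D⁻¹ i j) = 1 ∧
    nonB0Block F k K (fun i j => D⁻¹ i j) * nonB0Block F k K (fun i j => D i j) = 1 := by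
  have hdet : IsUnit D.det := (Matrix.isUnit_iff_isUnit_det D).1 hU
  obtain ⟨hDl, _⟩ := patterns_of_blockDiag F hD
  obtain ⟨hIl, hIr⟩ := patterns_inv_of_blockDiag F hD hU
  refine ⟨?_, ?_, ?_⟩
  · rw [nonB0Block_mul_right F (D * M) D⁻¹ hIr, nonB0Block_mul_left F D M hDl]
  · rw [← nonB0Block_mul_left F D D⁻¹ hDl, Matrix.mul_nonsing_inv _ hdet, nonB0Block_one]
  · rw [← nonB0Block_mul_left F D⁻¹ D hIl, Matrix.nonsing_inv_mul _ hdet, nonB0Block_one]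

end NonB0

/-! ## §4  ROW (d): invariance under the (1.10) action -/

section Gauge

variable (F : T4Family)

open scoped Classical in
/-- ★ **ROW (d) for the unsubtracted piece**: under (P3) piecewise covariance through an invertible bond-block-diagonal `AdM u` and (g6) invariance of the resolvent pieces,
`G_X(φ^u) = G_X(φ)` for every units-valued `u`. [cite: Balaban1987RG1, (1.19) p.263, (1.10) p.262] -/
theorem lzdetGPiece_cAct (Mc k K : ℕ)
    (TYK : (recordDomSys F Mc k K).Dom → Sect2.CPair (F.P K) (MatA 2) → FluctIdx F k K → FluctIdx F k K → ℂ)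
    (EGK : ℝ → (recordDomSys F Mc k K).Dom → Sect2.CPair (F.P K) (MatA 2) → ℂ) (R : ℝ) (X : (recordDomSys F Mc k K).Dom)
    (u : Site (F.P K) 0 → (MatA 2)ˣ) (AdMu : Matrix (FluctIdx F k K) (FluctIdx F k K) ℂ) (hU : IsUnit AdMu)
    (hdiag : ∀ i j : FluctIdx F k K, i.1 ≠ j.1 → AdMu i j = 0)
    (hcov : ∀ (Y : (recordDomSys F Mc k K).Dom) (φ : Sect2.CPair (F.P K) (MatA 2)), Matrix.of (TYK Y (Sect2.cAct u φ)) = AdMu * Matrix.of (TYK Y φ) * AdMu⁻¹)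
    (hEG : ∀ (x : ℝ) (φ : Sect2.CPair (F.P K) (MatA 2)), EGK x X (Sect2.cAct u φ) = EGK x X φ)
    (φ : Sect2.CPair (F.P K) (MatA 2)) :
    lzdetGPiece F Mc k K TYK EGK R X (Sect2.cAct u φ) = lzdetGPiece F Mc k K TYK EGK R X φ := by
  unfold lzdetGPiece
  have hint : (∫ x in (0 : ℝ)..R, EGK x X (Sect2.cAct u φ)) = ∫ x in (0 : ℝ)..R, EGK x X φ :=
    intervalIntegral.integral_congr fun x _ => hEG x φ
  obtain ⟨-, hAB, hBA⟩ := nonB0Block_conj F hdiag hU 1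
  have hT : (fun Y : (recordDomSys F Mc k K).Dom => nonB0Block F k K (TYK Y (Sect2.cAct u φ))) =
      fun Y => nonB0Block F k K (fun i j => AdMu i j) * nonB0Block F k K (TYK Y φ) * nonB0Block F k K (fun i j => AdMu⁻¹ i j) := by
    funext Y
    have h1 : nonB0Block F k K (TYK Y (Sect2.cAct u φ)) = nonB0Block F k K (fun i j => (AdMu * Matrix.of (TYK Y φ) * AdMu⁻¹) i j) := by
      ext i j; simp only [nonB0Block, Matrix.of_apply]; rw [← hcov Y φ]; rfl
    rw [h1, (nonB0Block_conj F hdiag hU (Matrix.of (TYK Y φ))).1]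
    rfl
  rw [hint, hT, powMemberPiece_conj _ hAB hBA]

open scoped Classical in
/-- ★ **ROW (d)**: `lzdetPiece … X (φ^u) = lzdetPiece … X φ`. [cite: Balaban1987RG1, (1.19) p.263, (1.10) p.262] -/
theorem lzdetPiece_cAct (Mc k K : ℕ)
    (TYK : (recordDomSys F Mc k K).Dom → Sect2.CPair (F.P K) (MatA 2) → FluctIdx F k K → FluctIdx F k K → ℂ)
    (EGK : ℝ → (recordDomSys F Mc k K).Dom → Sect2.CPair (F.P K) (MatA 2) → ℂ) (R : ℝ) (X : (recordDomSys F Mc k K).Dom)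
    (u : Site (F.P K) 0 → (MatA 2)ˣ) (AdMu : Matrix (FluctIdx F k K) (FluctIdx F k K) ℂ) (hU : IsUnit AdMu)
    (hdiag : ∀ i j : FluctIdx F k K, i.1 ≠ j.1 → AdMu i j = 0)
    (hcov : ∀ (Y : (recordDomSys F Mc k K).Dom) (φ : Sect2.CPair (F.P K) (MatA 2)), Matrix.of (TYK Y (Sect2.cAct u φ)) = AdMu * Matrix.of (TYK Y φ) * AdMu⁻¹)
    (hEG : ∀ (x : ℝ) (φ : Sect2.CPair (F.P K) (MatA 2)), EGK x X (Sect2.cAct u φ) = EGK x X φ)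
    (φ : Sect2.CPair (F.P K) (MatA 2)) :
    lzdetPiece F Mc k K TYK EGK R X (Sect2.cAct u φ) = lzdetPiece F Mc k K TYK EGK R X φ := by
  unfold lzdetPiece
  rw [lzdetGPiece_cAct F Mc k K TYK EGK R X u AdMu hU hdiag hcov hEG φ]

end Gauge

end Summit.QuantumFields.YangMills.Theorems.BalabanUVNodesPortS1

end
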